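import Mathlib

/-!
# P7CertificateCxD — the finite arithmetic behind the residual instance I-1 (P7-InstanceTable.md; p4-open-instance-dim6)

Setting (paper side): `C` = simple CM surface with CM by `K_C = ℚ(ζ₅)`, CM type `Φ_C = {0, 1}` in the coordinates
`Σ_C = Hom(K_C, ℂ) ≅ ℤ/4` (`j ↔ σ_{2^j}`); `D` = simple CM fourfold with CM by the NON-abelian octic CM field
`K_D = ℚ(ζ₅)(√(7+√5))`, `Σ_D = Hom(K_D, ℂ) ≅ ℤ/4 × {±}`, CM type `Φ_D = {(0,+), (0,−), (1,+), (3,−)}`.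
The Galois group `G` of the closure `L` (order 16) acts on `Σ_D` by `(j, ε) ↦ (j + m, s(j)·ε)` with `s` constant on
`{0,2}` and on `{1,3}` — all 16 such maps (p4 §1); on `Σ_C` through `j ↦ j + m`. Complex conjugation is `(m, s) = (2, +, +)`.
We encode `G` as the 16 triples `(m, s₀, s₁) ∈ ℤ/4 × Bool × Bool` (`s₀` = sign on even `j`, `s₁` on odd `j`;
`true = +`), points of `Σ_D` as `ℤ/4 × Bool`.

Certified (by `decide`, standard axioms): `cmType_C`, `cmType_D` (CM types), `primitive_D` (the right stabiliser of the induced type is exactly `H_D = Gal(L/K_D)`), `Δ_hodge` (the balance table over all 16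
`τ`: `|Δ_C ∩ τΦ_C| + |Δ_D ∩ τΦ_D| = 2`), `orbit_card` (4), `stab` (= the 4 elements acting trivially on `Σ_C`, i.e.
`Gal(L/ℚ(ζ₅))`), `no_hodge_pair` (no balanced 2-subset), `conj_is_square` (complex conjugation is a square in `G`, hence lies in every index-2 subgroup: `L` has no imaginary quadratic subfield, so there are no imaginary-quadratic Weil classes at all), and the certificate `χ(m, s) = i^m` (odd, order 4, trivial on the stabiliser): `χ_sum_ΔC = 1 + i ≠ 0`,
`χ_pair` (vanishes on conjugate pairs). Interpretation: Lemma 2.2 / Cor 2.3 of p7-minimal-instances.md — the orbit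
piece `B_Δ ⊂ H⁴(C × D)` meets the algebra generated by divisor classes (and, vacuously, imaginary-quadratic Weil
classes) only in `0`. `K_D` is not abelian, so `D` is not of Fermat type (Shioda 1981 Def. 2.1): nothing in HOME applies.
-/

namespace HodgeRepro0.P7CertificateCxD

open Finset

/-- Elements of `G`: `(m, s₀, s₁)`. -/
abbrev Elt := ZMod 4 × Bool × Bool

/-- Points of `Σ_D`. -/
abbrev PtD := ZMod 4 × Bool

/-- The whole group `G` (all 16 triples). -/
def G : Finset Elt := Finset.univ

/-- Action of `g = (m, s₀, s₁)` on `Σ_D`: `(j, ε) ↦ (j + m, s(j) ε)` with `s(j) = s₀` for `j` even, `s₁` for `j` odd. -/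
def actD (g : Elt) (p : PtD) : PtD :=
  (p.1 + g.1, if p.1.val % 2 = 0 then (p.2 == g.2.1) else (p.2 == g.2.2))

/-- Action on `Σ_C = ℤ/4`: `j ↦ j + m`. -/
def actC (g : Elt) (j : ZMod 4) : ZMod 4 := j + g.1

/-- Group law: `(g * h)(p) = g (h p)`. -/
def mul (g h : Elt) : Elt :=
  (g.1 + h.1, (if h.1.val % 2 = 0 then g.2.1 else g.2.2) == h.2.1,
              (if h.1.val % 2 = 0 then g.2.2 else g.2.1) == h.2.2)

/-- `mul` realises composition of the actions on `Σ_D`. -/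
theorem mul_act : ∀ g h : Elt, ∀ p : PtD, actD (mul g h) p = actD g (actD h p) := by decide

/-- Complex conjugation. -/
def conj : Elt := (2, true, true)

/-- `conj` acts on `Σ_D` as `(j, ε) ↦ (j+2, ε)` and is central. -/
theorem conj_act : (∀ p : PtD, actD conj p = (p.1 + 2, p.2)) ∧ (∀ g : Elt, mul conj g = mul g conj) := by decide

/-- CM type of `C`. -/
def ΦC : Finset (ZMod 4) := {0, 1}

/-- CM type of `D`. -/
def ΦD : Finset PtD := {(0, true), (0, false), (1, true), (3, false)}

/-- `Δ_C = {0, 1}` and `Δ_D = {(2,+), (2,−)}`. -/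
def ΔC : Finset (ZMod 4) := {0, 1}

/-- The `D`-part of `Δ`. -/
def ΔD : Finset PtD := {(2, true), (2, false)}

/-- `Φ_C` is a CM type (`ι : j ↦ j + 2`). -/
theorem cmType_C : ∀ j : ZMod 4, (j ∈ ΦC ↔ (j + 2) ∉ ΦC) := by decide

/-- `Φ_D` is a CM type. -/
theorem cmType_D : ∀ p : PtD, (p ∈ ΦD ↔ actD conj p ∉ ΦD) := by decide

/-- `H_D = Gal(L/K_D)`: the stabiliser of the base point `(0,+)`. -/
def HD : Finset Elt := G.filter (fun h => actD h (0, true) = (0, true))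

/-- The induced type `Φ̃_D = {g ∈ G : g·(0,+) ∈ Φ_D}` (preimage of `Φ_D` in `G`). -/
def ΦDt : Finset Elt := G.filter (fun g => actD g (0, true) ∈ ΦD)

/-- Primitivity of `Φ_D`: the right stabiliser `{h : Φ̃_D · h = Φ̃_D}` is exactly `H_D` (so `Φ_D` is induced from no
proper subfield; Shimura–Taniyama: `D` is simple with `End⁰(D) = K_D`). -/
theorem primitive_D : G.filter (fun h => ΦDt.image (fun g => mul g h) = ΦDt) = HD := by decide

/-- `|H_D| = 2` and `|Φ̃_D| = 8` (sanity). -/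
theorem HD_card : HD.card = 2 ∧ ΦDt.card = 8 := by decide

/-- `|S ∩ τΦ|` for a pair of subsets. -/
def cnt (SC : Finset (ZMod 4)) (SD : Finset PtD) (τ : Elt) : ℕ :=
  (SC ∩ ΦC.image (actC τ)).card + (SD ∩ ΦD.image (actD τ)).card

/-- Balance condition. -/
def IsHodgeSet (SC : Finset (ZMod 4)) (SD : Finset PtD) : Prop :=
  ∀ τ ∈ G, 2 * cnt SC SD τ = SC.card + SD.card

/-- Decidability of the balance condition. -/
instance (SC : Finset (ZMod 4)) (SD : Finset PtD) : Decidable (IsHodgeSet SC SD) := by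
  unfold IsHodgeSet; infer_instance

/-- `Δ` is balanced: `e_Δ` is a Hodge class of type (2,2) (the table of p4 §2). -/
theorem Δ_hodge : IsHodgeSet ΔC ΔD := by decide

/-- The orbit of `Δ` under `G` has 4 elements. -/
theorem orbit_card : (G.image (fun τ => (ΔC.image (actC τ), ΔD.image (actD τ)))).card = 4 := by decide

/-- The stabiliser of `Δ` is the subgroup acting trivially on `Σ_C` (i.e. `Gal(L/ℚ(ζ₅))`, order 4). -/
theorem stab :
    G.filter (fun τ => ΔC.image (actC τ) = ΔC ∧ ΔD.image (actD τ) = ΔD) = G.filter (fun τ => τ.1 = 0) := by decide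

/-- No 2-element subset of `Δ` is balanced (the six cases of p4 §2): the pair inside `Δ_C`. -/
theorem no_hodge_pair_C : ¬ IsHodgeSet ΔC ∅ := by decide

/-- The pair inside `Δ_D`. -/
theorem no_hodge_pair_D : ¬ IsHodgeSet ∅ ΔD := by decide

/-- The four mixed pairs. -/
theorem no_hodge_pair_mixed :
    ¬ IsHodgeSet {0} {(2, true)} ∧ ¬ IsHodgeSet {0} {(2, false)} ∧
    ¬ IsHodgeSet {1} {(2, true)} ∧ ¬ IsHodgeSet {1} {(2, false)} := by decide

/-- `conj` is a square in `G`. Every index-2 subgroup of a group contains all squares; hence every index-2 subgroup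
of `G` contains complex conjugation — `L` has no imaginary quadratic subfield, and there are no imaginary-quadratic
Weil classes on any power of `C × D` (the group-theoretic step «index 2 ⇒ contains squares» is not formalised here). -/
theorem conj_is_square : mul (1, true, true) (1, true, true) = conj := by decide

/-- The certificate character `χ(m, s) = i^m` (a homomorphism `G → ℤ[i]ˣ`, trivial on the stabiliser of `Δ`). -/
def χ (g : Elt) : GaussianInt :=
  if g.1 = 0 then 1 else if g.1 = 1 then ⟨0, 1⟩ else if g.1 = 2 then -1 else ⟨0, -1⟩

/-- `χ` is multiplicative, odd and of order 4. -/
theorem χ_hom : (∀ g h : Elt, χ (mul g h) = χ g * χ h) ∧ χ conj = -1 ∧ χ (1, true, true) * χ (1, true, true) = -1 := by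
  decide

/-- `χ` on `Σ_C = ℤ/4` (through which it factors): `χ_C(j) = i^j`. -/
def χC (j : ZMod 4) : GaussianInt := χ (j, true, true)

/-- The certificate value `Σ_{j ∈ Δ_C} χ_C(j) = 1 + i ≠ 0`. -/
theorem χ_sum_ΔC : ΔC.sum χC = ⟨1, 1⟩ ∧ ΔC.sum χC ≠ 0 := by decide

/-- `χ_C` vanishes on every conjugate pair `{j, j + 2}` (characters of divisor classes on `C`). -/
theorem χ_pair : ∀ j : ZMod 4, χC j + χC (j + 2) = 0 := by decide

/-- Packaged certificate for I-1. -/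
theorem certificate :
    IsHodgeSet ΔC ΔD ∧
    (G.image (fun τ => (ΔC.image (actC τ), ΔD.image (actD τ)))).card = 4 ∧
    mul (1, true, true) (1, true, true) = conj ∧
    ΔC.sum χC ≠ 0 ∧ (∀ j : ZMod 4, χC j + χC (j + 2) = 0) :=
  ⟨Δ_hodge, orbit_card, conj_is_square, χ_sum_ΔC.2, χ_pair⟩

end HodgeRepro0.P7CertificateCxD
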